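import Mathlib
import HarnessLib
import Summits.HubbardSuperconductivity.HubbardSuperconductivity.Theorems.KLProgrammeKLRegimeThinPairFlowPiece
import Summits.HubbardSuperconductivity.HubbardSuperconductivity.Theorems.KLProgrammeKLRegimeThinPairFlowData
import Summits.HubbardSuperconductivity.HubbardSuperconductivity.Theorems.KLProgrammeKLRegimeThinPairRateAtoms
import Summits.HubbardSuperconductivity.HubbardSuperconductivity.Theorems.KLProgrammeKLRegimeThinPairThresholds
import Summits.HubbardSuperconductivity.HubbardSuperconductivity.Theorems.KLProgrammeKLRegimeThinPairRegimeScalars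
import Summits.HubbardSuperconductivity.HubbardSuperconductivity.Theorems.KLProgrammeKLRegimeSymbolFrameProfileFourth
import Summits.HubbardSuperconductivity.HubbardSuperconductivity.Theorems.KLProgrammeKLRegimeEngineSymbolThresholds
import Summits.HubbardSuperconductivity.HubbardSuperconductivity.Theorems.KLProgrammeH10TwoPointLimitFramePerturbation
import Summits.HubbardSuperconductivity.HubbardSuperconductivity.Theorems.KLProgrammeKLRegimeEngineOverlapMeanFreeFlowData
import Summits.HubbardSuperconductivity.HubbardSuperconductivity.Theorems.KLProgrammeKLRegimeAlphaWtMeanFreeBaseDoors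

/-!
# K3 ENGINE child (stmt-HubbardSuperconductivity-20437), stub (b) (ℓ)/(I1′) below the deep window — the W2 (OVERLAP) twin of (D5), brick (W2):
# the weighted `ℓ¹` bound of the thin-pair frame difference across ONE STEP OF THE MEAN-FREE CHAIN `(K♯_i, K♯_{i+1})`, every pair, in the KL regime
# — REGISTERED-BINDER form: the (K5′) clauses from `m = 1` on, `∀ m, 1 ≤ m → m < n → FlowPieceOscAt … m` (stub (b) rev 14, token #25)

Cell `gate-hubbard-kl`, seat hubbard-kl-k3c3-p2 (g12); F1-W2-DESIGN §2 (W2).  This is p3's `charSumWt_thinPairDiff_flow` (…ThinPairFlow, 20440 #23, raw flow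
chain) RE-KEYED to the mean-free chain of (D5): the two frames are `K♯_i = K_i ⊖ symInterp (Σ_{m∈Ico i n} mean_m)` and `K♯_{i+1}` (admissible with the bumped
package `R♭ = ⟨cr, cz, Gfr[0 ↦ Gfr₀ + cr·e₀]⟩`, `meanFree_flow_frames`; `C²` size `A = κ₀/4` under the bumped door `klEngU₀3_le_min_div_bumped`), the band
increment is the mean-free piece (`meanFree_flow_piece`) with the `U²`-currency amplitude **`G₀ = (c″ + Gfr₁ + Gfr₂ + Gfr₃ + 1)·U²`** (order 0 from
`FlowPieceOscAt`, the (K5′) clause) in place of `(ΣGfr + 1)|U|`; the jet ratios `G₁,G₂,G₃ = 2G₀,4G₀,8G₀`, the rates `ρ = ρ₃ = 1/(4(Q+1))`, the time rate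
`s₀ = Λ_{k+1}β/(MπΘ_c)`, the thirteen thresholds from the depth `2(k+1)+5 ≤ i` and every other line of p3's proof are unchanged (composition BY NAME of
…ThinPairFlowPiece/…RateAtoms/…Thresholds/…RegimeScalars).  Extra binders w.r.t. p3: `0 ≤ c″`, `c″U ≤ 1`, `IsKLRegime U cc (−n)`, `∀ m, 1 ≤ m → m < n → FlowPieceOscAt … m` — EXACTLY stub (b)'s registered (K5′) history binder
(rev 14: the clause starts at `m = 1`; `…EngineOverlapMeanFreePiece` (p628787) asked it from `m = 0`, which the registered binder does not supply — this file
supersedes it for consumers; the telescope only ever reads pieces `i ≥ 2(k+1)+5 ≥ 7`).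

* **`charSumWt_thinPairDiff_meanFree'`** — `∃ d Ba Q Θ_c A` (absolute) such that along every admissible history, on every lattice `V` (`klEngL₃ ≤ V`), for all
  `k, i` with `2(k+1)+5 ≤ i`, `i+1 ≤ n`, and every pair `(ω′, a′)`: the rate-currency weighted `ℓ¹` of the thin-pair frame difference between `K♯_i` and `K♯_{i+1}`
  is `≤` p3's per-piece bound with `G₀ = (c″ + Gfr₁ + Gfr₂ + Gfr₃ + 1)·U²` (amplitude `∝ G₀/x`, `x = 4^i`).

Why `U²` matters here (design memo §1): the telescope's per-piece rows carry an x-free part `∝ G₀` (weight slope `Λ_{k+1}` ≫ piece scale `4^{−i}`), so the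
`(n − m₀)`-term sum is `∝ n·G₀ ≤ (c″+ΣGfr+1)·cc/log 4` only in this currency.  No definitions, no sorry.  Nothing asserts any stub, K3 or superconductivity.
[cite: BenfattoGiulianiMastropietro2006, §2.4 (2.36), §2.5 Lemma 2.2, §2.7 (2.69)–(2.71a), §2.8 (2.77), §3 (3.2)–(3.8)]
-/

noncomputable section

namespace Summit.HubbardSuperconductivity.HubbardSuperconductivity.Theorems.TorusFourierL2

set_option linter.dupNamespace false -- summit = problem name (single-conjunct summit), D-0017

open Set Finset Filter Topology Literature.MathematicalPhysics.QuantumLattice Literature.MathematicalPhysics.QuantumLattice.BandSectorCounting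
open Literature.MathematicalPhysics.QuantumLattice.FermiRG Literature.Probability.LatticeModels Literature.Analysis.SpecialFunctions Literature.Analysis.Calculus
open Summit.HubbardSuperconductivity.HubbardSuperconductivity.Theorems.DispersionFlow
open Summit.HubbardSuperconductivity.HubbardSuperconductivity.Theorems.KLRegimeSplit
open Summit.HubbardSuperconductivity.HubbardSuperconductivity.Theorems.KLProgrammeLegKernels
open Summit.HubbardSuperconductivity.HubbardSuperconductivity.Theorems.PerturbedFermiCurve
open scoped Real Nat

open Classical

set_option maxHeartbeats 8000000 in -- one application of the 440-binder per-piece lemma with 192 names instantiated by `rfl`, four rate-atom instances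
/-- **The thin-pair frame difference across one step of the mean-free chain, every pair, in the KL regime** (see the module docstring).
[cite: BenfattoGiulianiMastropietro2006, §2.4 (2.36), §2.5 Lemma 2.2, §2.7 (2.69)–(2.71a), §2.8 (2.77), §3 (3.2)–(3.8)] -/
theorem charSumWt_thinPairDiff_meanFree' (ha : (-4 : ℝ) < -(6 / 5)) (hab : (-(6 / 5) : ℝ) ≤ -(1 / 10)) (hb : (-(1 / 10) : ℝ) < 0) :
    ∃ d Ba Q Θc A : ℝ, 0 ≤ d ∧ 0 ≤ Ba ∧ 0 ≤ Q ∧ 1 ≤ Θc ∧ 0 ≤ A ∧ 2 * A < (bandBounds ha hab hb).Dtmin ∧ 4 * A < 2 * (bandBounds ha hab hb).rhomin ∧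
      ∀ (G : GeoConsts) (P : SplitConsts) (R : RenConsts) (Qe : EngConsts) (cc : ℝ), R.WF2 → 0 < cc → cc ≤ EngineV8.klEngC₃6 P R →
      ∀ μ ∈ klWindowC, ∀ U : ℝ, 0 < U → U ≤ min (EngineV8.klEngU₀3 P R cc) (1 / (R.Gfr 3 + 1)) → ∀ c'' : ℝ, 0 ≤ c'' → c'' * U ≤ 1 →
      ∀ β : ℝ, klBetaMin ≤ β → β ≤ Real.exp (cc / U ^ 2) →
      ∀ (L M : ℕ) [NeZero L] [NeZero M], EngineV8.klEngL₃ β U ≤ L → EngineV8.klEngM₃ β U L ≤ M →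
      ∀ n : ℕ, n ≤ nScales β + 1 → IsKLRegime U cc (-(n : ℤ)) → HistP klPredsV17F2 L M G P Qe R β U μ 0 n →
        (∀ m, 1 ≤ m → m < n → FlowPieceOscAt L M c'' β U μ m) →
        ∀ (V : ℕ) [NeZero V], EngineV8.klEngL₃ β U ≤ V →
        ∀ k i : ℕ, 2 * (k + 1) + 5 ≤ i → i + 1 ≤ n → ∀ (ω' : Fin (sectorCount (k + 1))) (a' : Fin (sectorCount k)),
    ∑ zz : TorusSite 1 (2 * M) × TorusSite 2 V,
        (1 + (klScale klE0 (k + 1) * β / (M * π * Θc)) * |(((zz.1 0).valMinAbs : ℤ) : ℝ)| + (1 / (4 * (Q + 1))) / (4 : ℝ) ^ i * |(((zz.2 0).valMinAbs : ℤ) : ℝ)| + (1 / (4 * (Q + 1))) / (4 : ℝ) ^ i * |(((zz.2 1).valMinAbs : ℤ) : ℝ)|) *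
          ‖∑ q : TorusSite 1 (2 * M) × TorusSite 2 V, (torusChar q.1 zz.1 * torusChar q.2 zz.2) •
            (klAnisoFamily V M β μ (fsub (klFlowFrameU L M β U μ (i + 1)) (symInterp L fun _ => ∑ m ∈ Ico (i + 1) n, klAngularMean (klLocalPart L M β U μ (klFlowFrameU L M β U μ m) m))) klE0 (k + 1) ω' (⟨(q.1 0).val, ZMod.val_lt (q.1 0)⟩, q.2) *
                klAnisoFamily V M β μ (fsub (klFlowFrameU L M β U μ (i + 1)) (symInterp L fun _ => ∑ m ∈ Ico (i + 1) n, klAngularMean (klLocalPart L M β U μ (klFlowFrameU L M β U μ m) m))) klE0 k a' (⟨(q.1 0).val, ZMod.val_lt (q.1 0)⟩, q.2) -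
              klAnisoFamily V M β μ (fsub (klFlowFrameU L M β U μ i) (symInterp L fun _ => ∑ m ∈ Ico i n, klAngularMean (klLocalPart L M β U μ (klFlowFrameU L M β U μ m) m))) klE0 (k + 1) ω' (⟨(q.1 0).val, ZMod.val_lt (q.1 0)⟩, q.2) *
                klAnisoFamily V M β μ (fsub (klFlowFrameU L M β U μ i) (symInterp L fun _ => ∑ m ∈ Ico i n, klAngularMean (klLocalPart L M β U μ (klFlowFrameU L M β U μ m) m))) klE0 k a' (⟨(q.1 0).val, ZMod.val_lt (q.1 0)⟩, q.2))‖ ≤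
      (4 : ℝ) ^ i * Real.sqrt (524288 * (1 / (klScale klE0 (k + 1) * β / (M * π * Θc)) + 1) * ((1 + 4 * Real.sqrt 2) ^ 2 * ((2 * Real.sqrt 2 / (1 / (4 * (Q + 1))) + 2) * (2 * Real.sqrt 2 / (1 / (4 * (Q + 1))) + 2)) + (1 / (1 / (4 * (Q + 1))) + 1) ^ 2)) *
        Real.sqrt (24 * (2 * M : ℕ) * (V : ℝ) ^ 2 *
          (2 * ((klScale klE0 (k + 1) * β / π + 1) *
            ((Real.sqrt 2 * V * ((klScale klE0 (k + 1) + (4 + 4 * A) *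
                ((klScale klE0 (k + 1) + (bandBounds ha hab hb).smax * (bandBounds ha hab hb).Dtmin * (3 * sectorWidth k / 4)) / ((bandBounds ha hab hb).Dtmin - 2 * A)) ^ 2) / (2 * (bandBounds ha hab hb).rhomin - 4 * A)) / π + 2) *
              (Real.sqrt 2 * V * (2 * ((klScale klE0 (k + 1) + (bandBounds ha hab hb).smax * (bandBounds ha hab hb).Dtmin * (3 * sectorWidth k / 4)) / ((bandBounds ha hab hb).Dtmin - 2 * A))) / π + 2))))) * ((d * klE0 ^ 2 / klScale klE0 (k + 1) ^ 2 * (((c'' + R.Gfr 1 + R.Gfr 2 + R.Gfr 3 + 1) * U ^ 2) / ((4 : ℝ) ^ i) ^ 2 * (2 * (klScale klE0 (k + 1) + ((c'' + R.Gfr 1 + R.Gfr 2 + R.Gfr 3 + 1) * U ^ 2) / ((4 : ℝ) ^ i) ^ 2) + ((c'' + R.Gfr 1 + R.Gfr 2 + R.Gfr 3 + 1) * U ^ 2) / ((4 : ℝ) ^ i) ^ 2))) + (d * klE0 ^ 2 / klScale klE0 k ^ 2 * (((c'' + R.Gfr 1 + R.Gfr 2 + R.Gfr 3 + 1) * U ^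 2) / ((4 : ℝ) ^ i) ^ 2 * (2 * (klScale klE0 k + ((c'' + R.Gfr 1 + R.Gfr 2 + R.Gfr 3 + 1) * U ^ 2) / ((4 : ℝ) ^ i) ^ 2) + ((c'' + R.Gfr 1 + R.Gfr 2 + R.Gfr 3 + 1) * U ^ 2) / ((4 : ℝ) ^ i) ^ 2)))) := by
  -- the window band bounds and the absolute frame-size threshold
  set B : BandBounds (-(6 / 5)) (-(1 / 10)) := bandBounds ha hab hb with hBdef
  set κ₀ : ℝ := min (min (B.Dtmin / 4) (B.rhomin / 4)) (1 / 40) with hκ₀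
  have hDt := B.Dtmin_pos
  have hrh := B.rhomin_pos
  have hsm := B.smax_pos
  have hκ₀pos : 0 < κ₀ := by rw [hκ₀]; exact lt_min (lt_min (by positivity) (by positivity)) (by norm_num)
  have hκ₀Dt : κ₀ ≤ B.Dtmin / 4 := (min_le_left _ _).trans (min_le_left _ _)
  have hκ₀rh : κ₀ ≤ B.rhomin / 4 := (min_le_left _ _).trans (min_le_right _ _)
  have hκ₀40 : κ₀ ≤ 1 / 40 := min_le_right _ _
  set A : ℝ := κ₀ / 4 with hAdef
  have hA0 : 0 < A := by rw [hAdef]; positivity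
  have hADt : 2 * A < B.Dtmin := by rw [hAdef]; linarith
  have hρA : 4 * A < 2 * B.rhomin := by rw [hAdef]; linarith
  have hDtA : 0 < B.Dtmin - 2 * A := by linarith
  -- cutoff and angular constants
  have he : (0 : ℝ) < klE0 := by norm_num [klE0]
  obtain ⟨d, hd0, hd1, hd2, hd3, hd4⟩ := exists_abs_derivs4_bgmCutoffSq_le he
  obtain ⟨Ba, hBa0, hB⟩ := exists_norm_iteratedDeriv_sectorWeightCirc_polarAngle_line_le 3
  -- the absolute slot / transport / cell constants
  obtain ⟨ρbar, hρbar⟩ : ∃ y : ℝ, y = (klE0 + B.smax * B.Dtmin * (3 * π / 4)) / (B.Dtmin - 2 * A) := ⟨_, rfl⟩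
  obtain ⟨Cab, hCab⟩ : ∃ y : ℝ, y = (5 * klE0 + B.smax * B.Dtmin * (15 * π / 4)) / (B.Dtmin - 2 * A) := ⟨_, rfl⟩
  obtain ⟨T₂, hT₂def⟩ : ∃ y : ℝ, y = (4 + 2 * A) + 14 * Cab + (28 / (B.Dtmin - 2 * A) + 4) := ⟨_, rfl⟩
  obtain ⟨T₀, hT₀⟩ : ∃ y : ℝ, y = T₂ + 7 * (Real.sqrt 2 * ρbar) := ⟨_, rfl⟩
  have hπ := Real.pi_pos
  have hρbar0 : 0 ≤ ρbar := by rw [hρbar]; exact div_nonneg (by positivity) hDtA.le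
  have hCab0 : 0 ≤ Cab := by rw [hCab]; exact div_nonneg (by positivity) hDtA.le
  have h28 : 0 ≤ 28 / (B.Dtmin - 2 * A) := div_nonneg (by norm_num) hDtA.le
  have hT₂0 : 4 + 2 * A ≤ T₂ := by rw [hT₂def]; nlinarith only [hCab0, h28]
  have h7 : 0 ≤ 7 * (Real.sqrt 2 * ρbar) := by positivity
  have hT₀0 : 0 ≤ T₀ := by rw [hT₀]; linarith only [hT₂0, hA0.le, h7]
  -- the uniform rate atoms
  obtain ⟨Q, hQ0, hQ⟩ := thinPair_rates_uniform (T₀ := T₀) (A := A) (ε₂ := 4 + 4 * A) (E₀ := 4) (E₁ := 11) (e₀ := klE0) (d := d) (Ba := Ba) (zc := 6)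
    (g₀ := 2) (g₁ := 4) (g₂ := 8) (g₃ := 16) (γ₁ := 2) (γ₂ := 4) (γ₃ := 8) hT₀0 hA0.le (by positivity) (by norm_num) (by norm_num) hd0 hBa0 (by norm_num)
    (by norm_num) (by norm_num) (by norm_num) (by norm_num) (by norm_num) (by norm_num) (by norm_num)
  -- the time coefficient
  obtain ⟨Θ, hΘ⟩ : ∃ y : ℝ, y = 8 * klE0 ^ 6 + 12 * klE0 ^ 4 + 6 * (2 * klE0 ^ 4 + klE0 ^ 2) * (2 * (d * klE0 ^ 2)) +
      6 * klE0 ^ 2 * (4 * (d * klE0 ^ 4) + 2 * (d * klE0 ^ 2)) + (8 * (d * klE0 ^ 6) + 12 * (d * klE0 ^ 4)) := ⟨_, rfl⟩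
  have hΘ0 : 0 ≤ Θ := by rw [hΘ]; positivity
  refine ⟨d, Ba, Q, max 1 Θ, A, hd0, hBa0, hQ0, le_max_left _ _, hA0.le, hADt, hρA, ?_⟩
  intro G P R Qe cc hR2 hcc hcc6 μ hμ U hU hUle c'' hc0 hcU β hβmin hβc L M _ _ hL3 hM3 n hnN hreg hhist hosc V _ hV3 k i hki hin ω' a'
  have hΘc1 : 1 ≤ max 1 Θ := le_max_left _ _
  have hΘc0 : 0 < max 1 Θ := lt_of_lt_of_le one_pos hΘc1
  -- the engine's thresholds imply the symbol layer's
  have hRj : ∀ j, 0 ≤ R.Gfr j := EngineV8.gfr_nonneg_of_wf2 hR2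
  have hβ0 : 0 < β := pos_of_klBetaMin_le hβmin
  have hcle := (hcc6.trans (EngineV8.klEngC₃6_le_klEngC₃3 P R)).trans (EngineV8.klEngC₃3_le_symbolC₃ ha hab hb P hRj)
  have hU3 := (hUle.trans (min_le_left _ _)).trans (EngineV8.klEngU₀3_le_symbolU₀ ha hab hb P hRj cc)
  have hU1 : U ≤ 1 := hU3.trans (min_le_left _ _)
  have hUabs1 : |U| ≤ 1 := by rw [abs_of_pos hU]; exact hU1
  have hUG : U ≤ 1 / (R.Gfr 3 + 1) := hUle.trans (min_le_right _ _)
  have hVβ : β ^ 2 ≤ (V : ℝ) := EngineV8.sq_le_of_klEngL₃_le hV3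
  have hMβ : β ≤ (M : ℝ) := EngineV8.le_of_klEngM₃_le hβmin hL3 hM3
  have hM0 : (0 : ℝ) < M := Nat.cast_pos.2 (Nat.pos_of_ne_zero (NeZero.ne M))
  have hGU : ∀ {j : ℕ}, j < 5 → R.Gfr j * U ≤ 1 / (2 : ℝ) ^ 120 := fun hj =>
    gfr_mul_le_of_le_klEngU₀3 P hU.le (hUle.trans (min_le_left _ _)) hj
  -- the `C²` size of every admissible frame is `≤ A = κ₀/4`
  have hlog : 1 ≤ Real.log 4 := by
    have h4 : Real.exp 1 ≤ 4 := by have := Real.exp_one_lt_d9; norm_num at this; linarith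
    calc (1 : ℝ) = Real.log (Real.exp 1) := (Real.log_exp 1).symm
      _ ≤ Real.log 4 := Real.log_le_log (Real.exp_pos 1) h4
  -- the bumped package of the mean-free frames and its doors
  have hcr : 0 ≤ R.cr := hR2.1.1
  set Rb : RenConsts := ⟨R.cr, R.cz, fun j => if j = 0 then R.Gfr 0 + R.cr * klE0 else R.Gfr j⟩ with hRb
  have hRb0 : Rb.Gfr 0 = R.Gfr 0 + R.cr * klE0 := by simp [hRb]
  have hRbj : ∀ j, j ≠ 0 → Rb.Gfr j = R.Gfr j := fun j hj => by simp [hRb, hj]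
  have hRbnn : ∀ j, 0 ≤ Rb.Gfr j := by
    intro j
    by_cases hj : j = 0
    · subst hj; rw [hRb0]; have := hRj 0; positivity
    · rw [hRbj j hj]; exact hRj j
  have hU3E : U ≤ EngineV8.klEngU₀3 P R cc := hUle.trans (min_le_left _ _)
  have hUd : U ≤ 1 / (2 ^ 12 * (R.Gfr 0 + R.Gfr 1 + R.cr + 1)) := hU3E.trans (klEngU₀3_le_inv_baseDoor P (hRj 0) (hRj 1) hcr cc)
  have hUkb : U ≤ (1 / 40) / (24 * (R.Gfr 0 + R.cr * klE0 + R.Gfr 1 + 1)) :=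
    hU3E.trans ((klEngU₀3_le_min_div_bumped P (hRj 0) (hRj 1) hcr cc).trans (min_le_right _ _))
  have hcc480 : cc ≤ 1 / (480 * (R.Gfr 2 + 1)) := by
    refine hcle.trans ?_
    have hG2 : 0 < 12 * (R.Gfr 2 + 1) := by have := hRj 2; positivity
    rw [div_le_div_iff₀ hG2 (by have := hRj 2; positivity)]
    have hk : min (min (B.Dtmin / 4) (B.rhomin / 4)) (1 / 40) ≤ 1 / 40 := min_le_right _ _
    nlinarith [hk, hRj 2]
  have hκ₀eq : κ₀ = 1 / 40 := by rw [hκ₀, hBdef]; exact EngineV8.symbolKappa_eq ha hab hb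
  have hAK : ∀ K : TrigPolyC4v, FrameOK Rb U (nScales β) μ K → ∀ p : Momentum, ∀ j ≤ 2, ‖iteratedFDeriv ℝ j (frameShift K) p‖ ≤ A := by
    intro K hK p j hj
    refine (norm_iteratedFDeriv_frameShift_le_of_frameOK_regime hRbnn hcc.le hβmin hβc hK p hj).trans ?_
    rw [hRb0, hRbj 1 one_ne_zero, hRbj 2 two_ne_zero]
    have h0 := hRj 0; have h1 := hRj 1; have h2 := hRj 2
    have he0 : (0 : ℝ) ≤ R.cr * klE0 := mul_nonneg hcr (by norm_num [klE0])
    rw [abs_of_pos hU]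
    have hU2 : U ^ 2 ≤ U := by nlinarith only [hU, hU1]
    have hA1 : 2 * (R.Gfr 0 + R.cr * klE0) * U + 2 * R.Gfr 1 * U ^ 2 ≤ 2 * (R.Gfr 0 + R.cr * klE0 + R.Gfr 1 + 1) * U := by
      have := mul_le_mul_of_nonneg_left hU2 h1
      nlinarith only [this, hU.le, he0, h0]
    have hB1 : 2 * (R.Gfr 0 + R.cr * klE0 + R.Gfr 1 + 1) * U ≤ κ₀ / 12 := by
      have hpos : 0 < 24 * (R.Gfr 0 + R.cr * klE0 + R.Gfr 1 + 1) := by positivity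
      have := (le_div_iff₀ hpos).mp hUkb
      rw [hκ₀eq]; linarith only [this]
    have hC1 : R.Gfr 2 * (cc / Real.log 4) ≤ R.Gfr 2 * cc := mul_le_mul_of_nonneg_left (div_le_self hcc.le hlog) h2
    have hD1 : R.Gfr 2 * cc ≤ κ₀ / 12 := by
      have hpos : 0 < 12 * (R.Gfr 2 + 1) := by positivity
      have := (le_div_iff₀ hpos).mp hcle
      linarith only [this, hcc.le]
    rw [hAdef]; linarith only [hA1, hB1, hC1, hD1, hκ₀pos]
  -- the window margins
  have hμ' := hμ
  simp only [klWindowC, Set.mem_Icc] at hμ'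
  have e1 : (-1.05 : ℝ) = -(21 / 20) := by norm_num
  have e2 : (-0.15 : ℝ) = -(3 / 20) := by norm_num
  have hμlo : -(21 / 20 : ℝ) ≤ μ := by rw [← e1]; exact hμ'.1
  have hμhi : μ ≤ -(3 / 20 : ℝ) := by rw [← e2]; exact hμ'.2
  have he0 : klE0 = 1 / 32 := rfl
  have hgap : klE0 + A + (1 / 10 : ℝ) ^ 2 < -μ := by rw [he0, hAdef]; linarith only [hμhi, hκ₀40]
  have h3 : klE0 + A - μ ≤ 3 := by rw [he0, hAdef]; linarith only [hμlo, hκ₀40]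
  have hlo : (-(6 / 5) : ℝ) ≤ μ - A - klE0 := by rw [he0, hAdef]; linarith only [hμlo, hκ₀40]
  have hhi : μ + A + klE0 ≤ -(1 / 10) := by rw [he0, hAdef]; linarith only [hμhi, hκ₀40]
  -- the scale thresholds at `k + 1` and `k`
  have hk1N : k + 1 ≤ nScales β + 1 := by omega
  obtain ⟨hMa, -, hLz, -, -⟩ := regime_scale_thresholds₃ hβmin hVβ hMβ hk1N
  obtain ⟨hMb, -, -, -, -⟩ := regime_scale_thresholds₃ hβmin hVβ hMβ (show k ≤ nScales β + 1 by omega)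
  have hNr : (2 : ℝ) ≤ (2 : ℝ) ^ (k + 1) := by
    calc (2 : ℝ) = 2 ^ 1 := by norm_num
      _ ≤ 2 ^ (k + 1) := pow_le_pow_right₀ (by norm_num) (by omega)
  -- the two frames and the piece
  have hi1 : 1 ≤ i := by omega
  obtain ⟨hfr1, hfr2, hA3, hA3', hK2, hK2', -⟩ := meanFree_flow_frames (L := L) (M := M) hR2 hμ hU hU1 hUd hcc.le hcc480 hreg hnN hhist hi1 hin
  have hh := (histP_klPredsV17F2_iff L M G P Qe R β U μ 0 n).1 hhist
  have hJ : ∀ m ≤ i, FlowPieceJetsAt L M β U μ R m := fun m hm => (hh m (by omega)).2.1.2.1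
  set G₀ : ℝ := (c'' + R.Gfr 1 + R.Gfr 2 + R.Gfr 3 + 1) * U ^ 2 with hG₀def
  have hU2pos : 0 < U ^ 2 := pow_pos hU 2
  have hG₀pos : 0 < G₀ := by rw [hG₀def]; have := hRj 1; have := hRj 2; have := hRj 3; positivity
  have hG₀2 : G₀ ≤ 2 := by
    rw [hG₀def]
    have h1 := hGU (j := 1) (by norm_num); have h2 := hGU (j := 2) (by norm_num); have h3 := hGU (j := 3) (by norm_num)
    have h120 : (1 : ℝ) / 2 ^ 120 ≤ 1 / 4 := by norm_num
    have hU12 : U ≤ 1 / 2 ^ 12 := hUd.trans (by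
      refine one_div_le_one_div_of_le (by positivity) ?_
      nlinarith only [hRj 0, hRj 1, hcr])
    have hcU2 : c'' * U ^ 2 ≤ U := by nlinarith only [hcU, hU]
    nlinarith only [h1, h2, h3, h120, hU1, hU, hU12, hcU2]
  have hGsum : (c'' + R.Gfr 1 + R.Gfr 2 + R.Gfr 3) * U ^ 2 ≤ G₀ := by rw [hG₀def]; nlinarith only [hU2pos]
  obtain ⟨ν, hν⟩ : ∃ ν : (Fin 2 → ℝ) → ℝ, ∀ p, ν p =
      frameLevel μ (fsub (klFlowFrameU L M β U μ i) (symInterp L fun _ =>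
          ∑ m ∈ Ico i n, klAngularMean (klLocalPart L M β U μ (klFlowFrameU L M β U μ m) m))) (WithLp.toLp 2 p) -
        frameLevel μ (fsub (klFlowFrameU L M β U μ (i + 1)) (symInterp L fun _ =>
          ∑ m ∈ Ico (i + 1) n, klAngularMean (klLocalPart L M β U μ (klFlowFrameU L M β U μ m) m))) (WithLp.toLp 2 p) := ⟨_, fun p => rfl⟩
  obtain ⟨hνs, hN₀, hN₁, hN₂, hN₃, hfd⟩ := meanFree_flow_piece (L := L) (M := M) (μ := μ) hRj hc0 (show i < n by omega) (hJ i le_rfl)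
    (hosc i (by omega) (by omega)) (x := (4 : ℝ) ^ i) rfl hGsum hν
  -- scale, depth and cell facts
  obtain ⟨hΛ0pos, hΛ1pos, hΛ0le1, hΛ1le1, hY1, hY0a, hY0b, hY1a, hY01, -, hζY⟩ := thinPair_scale_facts k
  obtain ⟨hYx, hx1, hGΛ, hNrx⟩ := thinPair_depth_facts hki hG₀2
  obtain ⟨hcab, hρa, hρb, hρa0, hρb0⟩ := thinPair_cells_step B hADt k
  obtain ⟨hρpos, hρQ, hρ₃Q⟩ := thinPair_rate_choice hQ0
  obtain ⟨hs₀, hsrate⟩ := thinPair_time_rate hβ0 (M := M) hΘc0 k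
  have hx0 : (0 : ℝ) < (4 : ℝ) ^ i := by positivity
  have hY1x : (1 : ℝ) ≤ 1 / klScale klE0 (k + 1) ^ 2 := hY1
  -- the third-size datum (affine in `x`)
  have hG3U : R.Gfr 3 * U ≤ 1 := by
    have hG3 := hRj 3
    calc R.Gfr 3 * U ≤ R.Gfr 3 * (1 / (R.Gfr 3 + 1)) := mul_le_mul_of_nonneg_left hUG hG3
      _ = R.Gfr 3 / (R.Gfr 3 + 1) := by ring
      _ ≤ 1 := by rw [div_le_one (by positivity)]; linarith only [hG3]
  have hε₃₁0 : 0 ≤ 32 * (R.Gfr 3 * U ^ 2) / 3 := by have := hRj 3; positivity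
  have hε₃₁E : 32 * (R.Gfr 3 * U ^ 2) / 3 ≤ 11 := by
    have : R.Gfr 3 * U ^ 2 ≤ 1 := by nlinarith only [hG3U, hU1, hU, hRj 3]
    linarith only [this]
  have hA₃x : 4 + 8 * (R.Gfr 3 * U ^ 2 * ((4 : ℝ) ^ i / 3)) ≤ 4 + 32 * (R.Gfr 3 * U ^ 2) / 3 * (4 : ℝ) ^ i := by
    have : 0 ≤ R.Gfr 3 * U ^ 2 * (4 : ℝ) ^ i := by have := hRj 3; positivity
    nlinarith only [this]
  have hA₃x' : 4 + 8 * (R.Gfr 3 * U ^ 2 * ((4 : ℝ) ^ (i + 1) / 3)) ≤ 4 + 32 * (R.Gfr 3 * U ^ 2) / 3 * (4 : ℝ) ^ i := by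
    rw [pow_succ]; apply le_of_eq; ring
  -- the transported tangency constant
  have hT₂ : (4 + 2 * A) + (2 * 7 * ((klScale klE0 k + B.smax * B.Dtmin * (3 * sectorWidth k / 4)) / (B.Dtmin - 2 * A) +
      (klScale klE0 (k + 1) + B.smax * B.Dtmin * (3 * sectorWidth (k + 1) / 4)) / (B.Dtmin - 2 * A) + G₀ / ((4 : ℝ) ^ i) ^ 2 / (B.Dtmin - 2 * A)) +
      2 * G₀ / (4 : ℝ) ^ i) * ((2 : ℝ) ^ (k + 1) + 1 / 2) ≤ T₂ := by
    rw [hT₂def, ← hCab] at *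
    have hN0 : 0 ≤ (2 : ℝ) ^ (k + 1) + 1 / 2 := by positivity
    -- `(G₀/x²)(N_r+½) ≤ G₀ ≤ 2` and `(2G₀/x)(N_r+½) ≤ 2G₀ ≤ 4`
    have u1 : G₀ / ((4 : ℝ) ^ i) ^ 2 * ((2 : ℝ) ^ (k + 1) + 1 / 2) ≤ 2 := by
      have hx2 : (4 : ℝ) ^ i ≤ ((4 : ℝ) ^ i) ^ 2 := by nlinarith only [hx1]
      have : ((2 : ℝ) ^ (k + 1) + 1 / 2) / ((4 : ℝ) ^ i) ^ 2 ≤ 1 := by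
        rw [div_le_one (by positivity)]; exact hNrx.trans hx2
      calc G₀ / ((4 : ℝ) ^ i) ^ 2 * ((2 : ℝ) ^ (k + 1) + 1 / 2) = G₀ * (((2 : ℝ) ^ (k + 1) + 1 / 2) / ((4 : ℝ) ^ i) ^ 2) := by ring
        _ ≤ 2 * 1 := mul_le_mul hG₀2 this (by positivity) (by norm_num)
        _ = 2 := by norm_num
    have u2 : 2 * G₀ / (4 : ℝ) ^ i * ((2 : ℝ) ^ (k + 1) + 1 / 2) ≤ 4 := by
      have : ((2 : ℝ) ^ (k + 1) + 1 / 2) / (4 : ℝ) ^ i ≤ 1 := by rw [div_le_one hx0]; exact hNrx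
      calc 2 * G₀ / (4 : ℝ) ^ i * ((2 : ℝ) ^ (k + 1) + 1 / 2) = 2 * G₀ * (((2 : ℝ) ^ (k + 1) + 1 / 2) / (4 : ℝ) ^ i) := by ring
        _ ≤ 2 * 2 * 1 := mul_le_mul (by linarith only [hG₀2]) this (by positivity) (by norm_num)
        _ = 4 := by norm_num
    have u3 := hcab
    have hinv : 0 < 1 / (B.Dtmin - 2 * A) := by positivity
    have e : (4 + 2 * A) + (2 * 7 * ((klScale klE0 k + B.smax * B.Dtmin * (3 * sectorWidth k / 4)) / (B.Dtmin - 2 * A) +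
        (klScale klE0 (k + 1) + B.smax * B.Dtmin * (3 * sectorWidth (k + 1) / 4)) / (B.Dtmin - 2 * A) + G₀ / ((4 : ℝ) ^ i) ^ 2 / (B.Dtmin - 2 * A)) +
        2 * G₀ / (4 : ℝ) ^ i) * ((2 : ℝ) ^ (k + 1) + 1 / 2) =
        (4 + 2 * A) + 14 * (((klScale klE0 k + B.smax * B.Dtmin * (3 * sectorWidth k / 4)) / (B.Dtmin - 2 * A) +
          (klScale klE0 (k + 1) + B.smax * B.Dtmin * (3 * sectorWidth (k + 1) / 4)) / (B.Dtmin - 2 * A)) * ((2 : ℝ) ^ (k + 1) + 1 / 2)) +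
          (14 * (1 / (B.Dtmin - 2 * A)) * (G₀ / ((4 : ℝ) ^ i) ^ 2 * ((2 : ℝ) ^ (k + 1) + 1 / 2)) + 2 * G₀ / (4 : ℝ) ^ i * ((2 : ℝ) ^ (k + 1) + 1 / 2)) := by
      field_simp
      ring
    rw [e]
    have t1 : 14 * (1 / (B.Dtmin - 2 * A)) * (G₀ / ((4 : ℝ) ^ i) ^ 2 * ((2 : ℝ) ^ (k + 1) + 1 / 2)) ≤ 14 * (1 / (B.Dtmin - 2 * A)) * 2 :=
      mul_le_mul_of_nonneg_left u1 (by positivity)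
    have e2 : 28 / (B.Dtmin - 2 * A) = 14 * (1 / (B.Dtmin - 2 * A)) * 2 := by ring
    nlinarith only [t1, u2, u3, e2, hCab0]
  -- the slot sizes of the four families are `≤ T₀`
  have htA0 : (0 : ℝ) ≤ 4 + 2 * A := by positivity
  have htAT : 4 + 2 * A ≤ T₀ := by rw [hT₀]; linarith only [hT₂0, h7]
  have hNr1 : (1 : ℝ) ≤ (2 : ℝ) ^ (k + 1) - 1 := by linarith only [hNr]
  have htB0 : (0 : ℝ) ≤ (4 + 2 * A) / ((2 : ℝ) ^ (k + 1) - 1) + 7 * (Real.sqrt 2 *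
      ((klScale klE0 k + B.smax * B.Dtmin * (3 * sectorWidth k / 4)) / (B.Dtmin - 2 * A))) := by positivity
  have htBT : (4 + 2 * A) / ((2 : ℝ) ^ (k + 1) - 1) + 7 * (Real.sqrt 2 *
      ((klScale klE0 k + B.smax * B.Dtmin * (3 * sectorWidth k / 4)) / (B.Dtmin - 2 * A))) ≤ T₀ := by
    rw [hT₀]
    have u1 : (4 + 2 * A) / ((2 : ℝ) ^ (k + 1) - 1) ≤ 4 + 2 * A := div_le_self htA0 hNr1
    have u2 : 7 * (Real.sqrt 2 * ((klScale klE0 k + B.smax * B.Dtmin * (3 * sectorWidth k / 4)) / (B.Dtmin - 2 * A))) ≤ 7 * (Real.sqrt 2 * ρbar) := by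
      rw [hρbar]; gcongr
    linarith only [u1, u2, hT₂0]
  have hT₂pos : 0 ≤ T₂ := htA0.trans hT₂0
  have htD0 : (0 : ℝ) ≤ T₂ / ((2 : ℝ) ^ (k + 1) - 1) + 7 * (Real.sqrt 2 *
      ((klScale klE0 (k + 1) + B.smax * B.Dtmin * (3 * sectorWidth (k + 1) / 4)) / (B.Dtmin - 2 * A))) := by positivity
  have htDT : T₂ / ((2 : ℝ) ^ (k + 1) - 1) + 7 * (Real.sqrt 2 *
      ((klScale klE0 (k + 1) + B.smax * B.Dtmin * (3 * sectorWidth (k + 1) / 4)) / (B.Dtmin - 2 * A))) ≤ T₀ := by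
    rw [hT₀]
    have u1 : T₂ / ((2 : ℝ) ^ (k + 1) - 1) ≤ T₂ := div_le_self hT₂pos hNr1
    have u2 : 7 * (Real.sqrt 2 * ((klScale klE0 (k + 1) + B.smax * B.Dtmin * (3 * sectorWidth (k + 1) / 4)) / (B.Dtmin - 2 * A))) ≤
        7 * (Real.sqrt 2 * ρbar) := by rw [hρbar]; gcongr
    linarith only [u1, u2]
  -- the angular sizes
  have hζA0 : (0 : ℝ) ≤ (1 + 6 * (sectorWidth (k + 1))⁻¹) + (1 + 6 * (sectorWidth k)⁻¹) := by
    have := sectorWidth_pos k; have := sectorWidth_pos (k + 1); positivity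
  have hζC0 : (0 : ℝ) ≤ (1 + 6 * (sectorWidth k)⁻¹) + (1 + 6 * (sectorWidth (k + 1))⁻¹) := by
    have := sectorWidth_pos k; have := sectorWidth_pos (k + 1); positivity
  have hζC : (1 + 6 * (sectorWidth k)⁻¹) + (1 + 6 * (sectorWidth (k + 1))⁻¹) ≤ 6 * (1 / klScale klE0 (k + 1) ^ 2) := by
    rw [add_comm]; exact hζY
  -- the size bounds of the increment
  have hG₁le : 2 * G₀ ≤ 4 := by linarith only [hG₀2]
  have hG₂le : 4 * G₀ ≤ 8 := by linarith only [hG₀2]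
  have hG₃le : 8 * G₀ ≤ 16 := by linarith only [hG₀2]
  -- the four rate-atom instances
  have famA := hQ (klScale klE0 (k + 1)) (klScale klE0 k) (1 / klScale klE0 (k + 1) ^ 2) (4 + 2 * A) G₀ (2 * G₀) (4 * G₀) (8 * G₀)
    ((1 + 6 * (sectorWidth (k + 1))⁻¹) + (1 + 6 * (sectorWidth k)⁻¹)) 4 (32 * (R.Gfr 3 * U ^ 2) / 3)
    _ _ _ _ _ _ _ _ _ _ _ _ _ _ _ _ _ _ _ _ _ _ _ _ _ _ _ _ _ _ _ _ _ _ _ _ _ _ _ _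
    hΛ1pos hΛ1le1 hY1x (hY1a) (le_refl _) hΛ0pos hY0a hY0b htA0 htAT hG₀pos hG₀2 rfl rfl rfl hG₁le hG₂le hG₃le hζA0 hζY
    (by norm_num) (by norm_num) hε₃₁0 hε₃₁E rfl rfl rfl rfl rfl rfl rfl rfl rfl rfl rfl rfl rfl rfl rfl rfl rfl rfl rfl rfl rfl rfl rfl
    rfl rfl rfl rfl rfl rfl rfl rfl rfl rfl rfl rfl rfl rfl rfl rfl rfl
  have famB := hQ (klScale klE0 (k + 1)) (klScale klE0 k) (1 / klScale klE0 (k + 1) ^ 2)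
    ((4 + 2 * A) / ((2 : ℝ) ^ (k + 1) - 1) + 7 * (Real.sqrt 2 * ((klScale klE0 k + B.smax * B.Dtmin * (3 * sectorWidth k / 4)) / (B.Dtmin - 2 * A))))
    G₀ (2 * G₀) (4 * G₀) (8 * G₀)
    ((1 + 6 * (sectorWidth (k + 1))⁻¹) + (1 + 6 * (sectorWidth k)⁻¹)) 4 (32 * (R.Gfr 3 * U ^ 2) / 3)
    _ _ _ _ _ _ _ _ _ _ _ _ _ _ _ _ _ _ _ _ _ _ _ _ _ _ _ _ _ _ _ _ _ _ _ _ _ _ _ _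
    hΛ1pos hΛ1le1 hY1x (hY1a) (le_refl _) hΛ0pos hY0a hY0b htB0 htBT hG₀pos hG₀2 rfl rfl rfl hG₁le hG₂le hG₃le hζA0 hζY
    (by norm_num) (by norm_num) hε₃₁0 hε₃₁E rfl rfl rfl rfl rfl rfl rfl rfl rfl rfl rfl rfl rfl rfl rfl rfl rfl rfl rfl rfl rfl rfl rfl
    rfl rfl rfl rfl rfl rfl rfl rfl rfl rfl rfl rfl rfl rfl rfl rfl rfl
  have famC := hQ (klScale klE0 k) (klScale klE0 (k + 1)) (1 / klScale klE0 (k + 1) ^ 2) (4 + 2 * A) G₀ (2 * G₀) (4 * G₀) (8 * G₀)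
    ((1 + 6 * (sectorWidth k)⁻¹) + (1 + 6 * (sectorWidth (k + 1))⁻¹)) 4 (32 * (R.Gfr 3 * U ^ 2) / 3)
    _ _ _ _ _ _ _ _ _ _ _ _ _ _ _ _ _ _ _ _ _ _ _ _ _ _ _ _ _ _ _ _ _ _ _ _ _ _ _ _
    hΛ0pos hΛ0le1 hY1x hY0a hY0b hΛ1pos hY1a (le_refl _) htA0 htAT hG₀pos hG₀2 rfl rfl rfl hG₁le hG₂le hG₃le hζC0 hζC
    (by norm_num) (by norm_num) hε₃₁0 hε₃₁E rfl rfl rfl rfl rfl rfl rfl rfl rfl rfl rfl rfl rfl rfl rfl rfl rfl rfl rfl rfl rfl rfl rfl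
    rfl rfl rfl rfl rfl rfl rfl rfl rfl rfl rfl rfl rfl rfl rfl rfl rfl
  have famD := hQ (klScale klE0 k) (klScale klE0 (k + 1)) (1 / klScale klE0 (k + 1) ^ 2)
    (T₂ / ((2 : ℝ) ^ (k + 1) - 1) + 7 * (Real.sqrt 2 * ((klScale klE0 (k + 1) + B.smax * B.Dtmin * (3 * sectorWidth (k + 1) / 4)) / (B.Dtmin - 2 * A))))
    G₀ (2 * G₀) (4 * G₀) (8 * G₀)
    ((1 + 6 * (sectorWidth k)⁻¹) + (1 + 6 * (sectorWidth (k + 1))⁻¹)) 4 (32 * (R.Gfr 3 * U ^ 2) / 3)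
    _ _ _ _ _ _ _ _ _ _ _ _ _ _ _ _ _ _ _ _ _ _ _ _ _ _ _ _ _ _ _ _ _ _ _ _ _ _ _ _
    hΛ0pos hΛ0le1 hY1x hY0a hY0b hΛ1pos hY1a (le_refl _) htD0 htDT hG₀pos hG₀2 rfl rfl rfl hG₁le hG₂le hG₃le hζC0 hζC
    (by norm_num) (by norm_num) hε₃₁0 hε₃₁E rfl rfl rfl rfl rfl rfl rfl rfl rfl rfl rfl rfl rfl rfl rfl rfl rfl rfl rfl rfl rfl rfl rfl
    rfl rfl rfl rfl rfl rfl rfl rfl rfl rfl rfl rfl rfl rfl rfl rfl rfl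
  obtain ⟨-, -, -, -, -, a₃₀, a₃₁, a₃₂, a₃₃⟩ := famA
  obtain ⟨-, -, b₂₀, b₂₁, b₂₂, b₃₀, b₃₁, b₃₂, b₃₃⟩ := famB
  obtain ⟨-, -, -, -, -, c₃₀, c₃₁, c₃₂, c₃₃⟩ := famC
  obtain ⟨-, -, d₂₀, d₂₁, d₂₂, d₃₀, d₃₁, d₃₂, d₃₃⟩ := famD
  -- the eleven space thresholds
  obtain ⟨⟨t₀, t₁, t₂, t₃⟩, ⟨tw₀, tw₁, tw₂⟩⟩ := thinPair_space_thresholds hQ0 hY1x hYx hρpos.le hρQ hρ₃Q a₃₀ a₃₁ a₃₂ a₃₃ c₃₀ c₃₁ c₃₂ c₃₃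
    b₂₀ b₂₁ b₂₂ d₂₀ d₂₁ d₂₂
  obtain ⟨⟨tv₀, tv₁, tv₂, tv₃⟩, -⟩ := thinPair_space_thresholds hQ0 hY1x hYx hρpos.le hρQ hρ₃Q b₃₀ b₃₁ b₃₂ b₃₃ d₃₀ d₃₁ d₃₂ d₃₃
    b₂₀ b₂₁ b₂₂ d₂₀ d₂₁ d₂₂
  -- the two time thresholds
  have hh0 : 0 ≤ |2 * π / β| := abs_nonneg _
  have hh2 : (2 * π / β) ^ 2 = |2 * π / β| ^ 2 := (sq_abs _).symm
  have hY₁0 : 0 ≤ 1 / klScale klE0 (k + 1) := by positivity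
  have hΘle : Θ ≤ max 1 Θ := le_max_right _ _
  obtain ⟨-, -, hθE⟩ := thinPair_timeCoeff_le' (e₀ := klE0) (lam := klScale klE0 (k + 1)) (lam' := klScale klE0 k) (Y₁ := 1 / klScale klE0 (k + 1))
    hd0 hΛ1pos hΛ0pos hh0 hh2 (le_refl _) hY01 rfl rfl rfl rfl rfl rfl rfl rfl rfl
  obtain ⟨-, -, hθF⟩ := thinPair_timeCoeff_le' (e₀ := klE0) (lam := klScale klE0 k) (lam' := klScale klE0 (k + 1)) (Y₁ := 1 / klScale klE0 (k + 1))
    hd0 hΛ0pos hΛ1pos hh0 hh2 hY01 (le_refl _) rfl rfl rfl rfl rfl rfl rfl rfl rfl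
  rw [← hΘ] at hθE hθF
  have tθ₁ := thinPair_time_threshold (M := M) hΘc1 hΘle hh0 hY₁0 hθE hsrate
  have tθ₂ := thinPair_time_threshold (M := M) hΘc1 hΘle hh0 hY₁0 hθF hsrate
  -- the per-piece lemma
  exact charSumWt_thinPairDiff_le_piece B (hAK _ hfr1) (hAK _ hfr2) hA3 hA3' hADt he (by norm_num : (0 : ℝ) < 1 / 10) (by norm_num : (1 / 10 : ℝ) ≤ 1)
    hgap h3 hlo hhi hβ0 hρA k hK2 hK2' hMa hMb hNr hLz rfl hd0 hd1 hd2 hd3 hd4 hBa0 hB hν hνs hx1 hG₀pos (by positivity : (0 : ℝ) ≤ 2 * G₀)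
    (by positivity : (0 : ℝ) ≤ 4 * G₀) (by positivity : (0 : ℝ) ≤ 8 * G₀) (by norm_num : (0 : ℝ) ≤ 4) hε₃₁0 hN₀ hN₁ hN₂ hN₃ hGΛ hA₃x hA₃x' hfd hT₂
    rfl rfl rfl rfl rfl rfl rfl rfl rfl rfl rfl rfl rfl rfl rfl rfl rfl rfl rfl rfl rfl rfl rfl rfl rfl rfl rfl rfl rfl rfl rfl rfl rfl rfl rfl rfl rfl rfl rfl rfl rfl rfl rfl rfl rfl rfl rfl rfl rfl rfl rfl rfl rfl rfl rfl rfl rfl rfl rfl rfl rfl rfl rfl rfl rfl rfl rfl rfl rfl rfl rfl rfl rfl rfl rfl rfl rfl rfl rfl rfl rfl rfl rfl rfl rfl rfl rfl rfl rfl rfl rfl rfl rfl rfl rfl rfl rfl rfl rfl rfl rfl rfl rfl rfl rfl rfl rfl rfl rfl rfl rfl rfl rfl rfl rfl rfl rfl rfl rfl rfl rfl rfl rfl rfl rfl rfl rfl rfl rfl rfl rfl rfl rfl rfl rfl rfl rfl rfl rfl rfl rfl rfl rfl rfl rfl rfl rfl rfl rfl rfl rfl rfl rfl rfl rfl rfl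 rfl rfl rfl rfl rfl rfl rfl rfl rfl rfl rfl rfl rfl rfl rfl rfl rfl rfl rfl rfl rfl rfl rfl rfl rfl rfl rfl rfl rfl rfl rfl rfl rfl rfl rfl rfl ω' a' hs₀ hρpos hρpos tθ₁ tθ₂ t₀ t₁ t₂ t₃ tv₀ tv₁ tv₂ tv₃ tw₀ tw₁ tw₂

end Summit.HubbardSuperconductivity.HubbardSuperconductivity.Theorems.TorusFourierL2

end
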